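import Mathlib
import Summits.ValiantsHypothesis.ValiantsHypothesis.Theorems.LiouvilleSarnakAlignedTypeICharactersMod2nKMTOnly
import HarnessLib

/-!
# Route LiouvilleSarnak — support `AlignedTypeI` (stmt-ValiantsHypothesis-21040), line `characters_mod_2n`:
# Parseval — the KMT variance IS a character mean square with one character removed

After `…CharactersMod2nKMTOnly.lean` the crux `AlignedTypeI` hinges on `KMTVariance` alone.  This file rewrites the
variance of the line (odd classes `u (mod 2^k)` along `b < 2^n`, main term carried by one character `χ₁`) EXACTLY as a
mean square of twisted Liouville sums over the characters `ψ ≠ χ₁` (Parseval on `(ℤ/2^k)ˣ`, the first step of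
Klurman–Mangerel–Teräväinen's proof, §4 of arXiv:1909.12280):

`Σ_{u ∈ (ℤ/2^k)ˣ} |Σ_{b<2^n} λ(u + 2^k b) − (χ₁(u)/φ(2^k)) Σ_{m ≤ x} λ(m) χ̄₁(m)|² = φ(2^k)⁻¹ Σ_{ψ ≠ χ₁} |Σ_{m ≤ x} λ(m) ψ(m)|²`

(`x = 2^(n+k)`; `variance_eq_charMeanSquare`), and records the resulting reduction of the crux to a statement about
character sums only (`alignedTypeI_of_charMeanSquare`, hypothesis spelled out, no definition; the converse
`charMeanSquare_of_kmtVariance` shows it is EQUIVALENT to `KMTVariance`): for every `ε > 0`, for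
`k₀ ≤ k ≤ n`, `n ≥ n₀`, some character `χ₁ (mod 2^k)` has `Σ_{ψ ≠ χ₁} |Σ_{m ≤ 2^(n+k)} λ(m) ψ(m)|² ≤ ε 4^(n+k)` — all
characters mod `2^k ≤ √x` but one are small against `λ` IN MEAN SQUARE (the large sieve gives `≪ 4^(n+k)` only).

HONEST FRAMING. Nothing conditional is discharged here: this is bookkeeping that pins the exact analytic residual of
the leaf (= the content of KMT 2023 Thm 1.3 for `λ` and `2`-power moduli). `AlignedTypeI` is NOT closed; nothing here
bears on `VP ≠ VNP` (NOT proved).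
-/

set_option linter.dupNamespace false

noncomputable section

namespace Summit.ValiantsHypothesis.ValiantsHypothesis.Theorems.LiouvilleSarnak.AlignedTypeI.CharactersModTwoN

open ArithmeticFunction Finset
open scoped BigOperators

/-! ## §1 Orthogonality on `(ℤ/q)ˣ` -/

/-- `Σ_{u ∈ (ℤ/q)ˣ} ψ(u) conj(ψ'(u)) = φ(q) [ψ = ψ']`. [folklore] -/
theorem sum_units_mul_conj {q : ℕ} [NeZero q] (ψ ψ' : DirichletCharacter ℂ q) :
    ∑ u : (ZMod q)ˣ, ψ (u : ZMod q) * star (ψ' (u : ZMod q)) =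
      if ψ = ψ' then (Nat.totient q : ℂ) else 0 := by
  have hconj : ∀ u : (ZMod q)ˣ, ψ (u : ZMod q) * star (ψ' (u : ZMod q)) = (ψ * ψ'⁻¹) (u : ZMod q) := by
    intro u
    rw [MulChar.star_apply', MulChar.mul_apply]
  simp_rw [hconj]
  split_ifs with h
  · subst h
    have h1 : ∀ u : (ZMod q)ˣ, (ψ * ψ⁻¹) (u : ZMod q) = 1 := fun u => by
      rw [mul_inv_cancel, MulChar.one_apply (Units.isUnit u)]
    simp_rw [h1]
    rw [Finset.sum_const, Finset.card_univ, ZMod.card_units_eq_totient, nsmul_eq_mul, mul_one]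
  · exact sum_units_eq_zero_of_ne_one (ψ * ψ'⁻¹) (fun h' => h (mul_inv_eq_one.mp h'))

/-- **Parseval on `(ℤ/q)ˣ`**: `Σ_u |Σ_ψ c(ψ) ψ(u)|² = φ(q) Σ_ψ |c(ψ)|²`. [folklore] -/
theorem parseval_units {q : ℕ} [NeZero q] (c : DirichletCharacter ℂ q → ℂ) :
    ∑ u : (ZMod q)ˣ, ‖∑ ψ : DirichletCharacter ℂ q, c ψ * ψ (u : ZMod q)‖ ^ 2 =
      (Nat.totient q : ℝ) * ∑ ψ : DirichletCharacter ℂ q, ‖c ψ‖ ^ 2 := by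
  -- work in `ℂ`: `‖z‖² = z · conj z`
  have key : ∀ u : (ZMod q)ˣ, ((‖∑ ψ : DirichletCharacter ℂ q, c ψ * ψ (u : ZMod q)‖ : ℂ)) ^ 2 =
      ∑ ψ : DirichletCharacter ℂ q, ∑ ψ' : DirichletCharacter ℂ q,
        c ψ * star (c ψ') * (ψ (u : ZMod q) * star (ψ' (u : ZMod q))) := by
    intro u
    rw [← Complex.mul_conj', map_sum, Finset.sum_mul_sum]
    refine Finset.sum_congr rfl fun ψ _ => Finset.sum_congr rfl fun ψ' _ => ?_
    rw [map_mul]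
    simp only [Complex.star_def]
    ring
  apply Complex.ofReal_injective
  push_cast
  rw [Finset.sum_congr rfl fun u (_ : u ∈ Finset.univ) => key u]
  calc ∑ u : (ZMod q)ˣ, ∑ ψ : DirichletCharacter ℂ q, ∑ ψ' : DirichletCharacter ℂ q,
        c ψ * star (c ψ') * (ψ (u : ZMod q) * star (ψ' (u : ZMod q)))
      = ∑ ψ : DirichletCharacter ℂ q, ∑ u : (ZMod q)ˣ, ∑ ψ' : DirichletCharacter ℂ q,
        c ψ * star (c ψ') * (ψ (u : ZMod q) * star (ψ' (u : ZMod q))) := Finset.sum_comm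
    _ = ∑ ψ : DirichletCharacter ℂ q, ∑ ψ' : DirichletCharacter ℂ q, ∑ u : (ZMod q)ˣ,
        c ψ * star (c ψ') * (ψ (u : ZMod q) * star (ψ' (u : ZMod q))) :=
        Finset.sum_congr rfl fun ψ _ => Finset.sum_comm
    _ = ∑ ψ : DirichletCharacter ℂ q, ∑ ψ' : DirichletCharacter ℂ q,
        c ψ * star (c ψ') * (if ψ = ψ' then (Nat.totient q : ℂ) else 0) := by
        refine Finset.sum_congr rfl fun ψ _ => Finset.sum_congr rfl fun ψ' _ => ?_
        rw [← Finset.mul_sum, sum_units_mul_conj]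
    _ = ∑ ψ : DirichletCharacter ℂ q, c ψ * star (c ψ) * (Nat.totient q : ℂ) := by
        refine Finset.sum_congr rfl fun ψ _ => ?_
        simp_rw [mul_ite, mul_zero]
        rw [Finset.sum_ite_eq]
        simp
    _ = (Nat.totient q : ℂ) * ∑ ψ : DirichletCharacter ℂ q, ((‖c ψ‖ : ℂ)) ^ 2 := by
        rw [Finset.mul_sum]
        refine Finset.sum_congr rfl fun ψ _ => ?_
        rw [← Complex.mul_conj', Complex.star_def]
        ring

/-! ## §2 The class sums through characters -/

/-- `Σ_ψ ψ(u) conj(ψ(m)) = φ(q) [m ≡ u]` for a unit `u` and any `m` (both sides vanish when `m` is not a unit).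
[folklore] -/
theorem sum_char_mul_conj_apply {q : ℕ} [NeZero q] (u : (ZMod q)ˣ) (m : ZMod q) :
    ∑ ψ : DirichletCharacter ℂ q, ψ (u : ZMod q) * star (ψ m) =
      if m = (u : ZMod q) then (Nat.totient q : ℂ) else 0 := by
  by_cases hm : IsUnit m
  · have hinv : ∀ ψ : DirichletCharacter ℂ q, star (ψ m) = ψ m⁻¹ := by
      intro ψ
      rw [MulChar.star_apply', MulChar.inv_apply_eq_inv']
      have h1 : ψ m * ψ m⁻¹ = 1 := by rw [← map_mul, ZMod.mul_inv_of_unit m hm, map_one]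
      exact (eq_inv_of_mul_eq_one_right h1).symm
    simp_rw [hinv]
    rw [show (∑ ψ : DirichletCharacter ℂ q, ψ (u : ZMod q) * ψ m⁻¹) =
        ∑ ψ : DirichletCharacter ℂ q, ψ m⁻¹ * ψ (u : ZMod q) from Finset.sum_congr rfl fun ψ _ => mul_comm _ _]
    exact DirichletCharacter.sum_char_inv_mul_char_eq ℂ hm (u : ZMod q)
  · have h0 : ∀ ψ : DirichletCharacter ℂ q, ψ m = 0 := fun ψ => ψ.map_nonunit hm
    simp_rw [h0, star_zero, mul_zero, Finset.sum_const_zero]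
    rw [if_neg]
    rintro rfl
    exact hm (Units.isUnit u)

/-- `φ(q) Σ_{1 ≤ m ≤ N, m ≡ u} λ(m) = Σ_ψ ψ(u) Σ_{1 ≤ m ≤ N} λ(m) conj ψ(m)`. [folklore] -/
theorem totient_mul_classSum_eq {q : ℕ} [NeZero q] (u : (ZMod q)ˣ) (N : ℕ) :
    (Nat.totient q : ℂ) * ∑ m ∈ (Finset.Icc 1 N).filter (fun m : ℕ => (m : ZMod q) = (u : ZMod q)),
        (liouville m : ℂ) =
      ∑ ψ : DirichletCharacter ℂ q, ψ (u : ZMod q) *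
        ∑ m ∈ Finset.Icc 1 N, (liouville m : ℂ) * star (ψ (m : ZMod q)) := by
  have hswap : ∑ ψ : DirichletCharacter ℂ q, ψ (u : ZMod q) *
      ∑ m ∈ Finset.Icc 1 N, (liouville m : ℂ) * star (ψ (m : ZMod q)) =
      ∑ m ∈ Finset.Icc 1 N, (liouville m : ℂ) *
        ∑ ψ : DirichletCharacter ℂ q, ψ (u : ZMod q) * star (ψ (m : ZMod q)) := by
    simp_rw [Finset.mul_sum]
    rw [Finset.sum_comm]
    exact Finset.sum_congr rfl fun m _ => Finset.sum_congr rfl fun ψ _ => by ring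
  rw [hswap, Finset.mul_sum, Finset.sum_filter]
  refine Finset.sum_congr rfl fun m _ => ?_
  rw [sum_char_mul_conj_apply u (m : ZMod q)]
  split_ifs <;> ring

/-! ## §3 The variance as a character mean square -/

/-- **Parseval for the KMT variance.**  For `k ≥ 1`, `x = 2^(n+k)` and any character `χ₁` mod `2^k`:
`Σ_{u ∈ (ℤ/2^k)ˣ} |Σ_{b<2^n} λ(u + 2^k b) − (χ₁(u)/φ) Σ_{m ≤ x} λ(m) χ̄₁(m)|² = φ⁻¹ Σ_{ψ ≠ χ₁} |Σ_{m ≤ x} λ(m) ψ(m)|²`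
(`φ = φ(2^k)`; sums over `m : Fin x` at `m + 1`, as in the line). [folklore] -/
theorem variance_eq_charMeanSquare (n k : ℕ) (hk : 1 ≤ k) (χ₁ : DirichletCharacter ℂ (2 ^ k)) :
    ∑ u : (ZMod (2 ^ k))ˣ,
      ‖(∑ b : Fin (2 ^ n), ((liouville ((u : ZMod (2 ^ k)).val + 2 ^ k * (b : ℕ)) : ℤ) : ℂ))
        - χ₁ (u : ZMod (2 ^ k)) / (Nat.totient (2 ^ k) : ℂ) *
          ∑ m : Fin (2 ^ (n + k)), ((liouville ((m : ℕ) + 1) : ℤ) : ℂ) *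
            star (χ₁ (((m : ℕ) + 1 : ℕ) : ZMod (2 ^ k)))‖ ^ 2 =
      (Nat.totient (2 ^ k) : ℝ)⁻¹ * ∑ ψ ∈ (Finset.univ : Finset (DirichletCharacter ℂ (2 ^ k))).erase χ₁,
        ‖∑ m : Fin (2 ^ (n + k)), ((liouville ((m : ℕ) + 1) : ℤ) : ℂ) * ψ (((m : ℕ) + 1 : ℕ) : ZMod (2 ^ k))‖ ^ 2 := by
  haveI : NeZero (2 ^ k) := ⟨pow_ne_zero _ two_ne_zero⟩
  have hφ0 : (0 : ℝ) < (Nat.totient (2 ^ k) : ℕ) := by exact_mod_cast Nat.totient_pos.mpr (pow_pos two_pos k)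
  have hφC : ((Nat.totient (2 ^ k) : ℕ) : ℂ) ≠ 0 := by exact_mod_cast hφ0.ne'
  -- the character sums `S ψ = Σ_{m ≤ N} λ(m) conj ψ(m)`
  set S : DirichletCharacter ℂ (2 ^ k) → ℂ := fun ψ =>
    ∑ m ∈ Finset.Icc 1 (2 ^ (n + k)), (liouville m : ℂ) * star (ψ (m : ZMod (2 ^ k))) with hS
  have hmain : ∀ ψ : DirichletCharacter ℂ (2 ^ k),
      (∑ m : Fin (2 ^ (n + k)), ((liouville ((m : ℕ) + 1) : ℤ) : ℂ) * star (ψ (((m : ℕ) + 1 : ℕ) : ZMod (2 ^ k)))) = S ψ := by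
    intro ψ
    rw [hS]
    exact sum_fin_succ_eq_sum_Icc (fun m => (liouville m : ℂ) * star (ψ (m : ZMod (2 ^ k)))) (2 ^ (n + k))
  have hfloorN : ⌊((2 : ℝ) ^ (n + k))⌋₊ = 2 ^ (n + k) := by
    rw [show ((2 : ℝ) ^ (n + k)) = ((2 ^ (n + k) : ℕ) : ℝ) by push_cast; rfl, Nat.floor_natCast]
  -- the class sums through characters
  have hA : ∀ u : (ZMod (2 ^ k))ˣ,
      (∑ b : Fin (2 ^ n), ((liouville ((u : ZMod (2 ^ k)).val + 2 ^ k * (b : ℕ)) : ℤ) : ℂ)) =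
        ((Nat.totient (2 ^ k) : ℕ) : ℂ)⁻¹ * ∑ ψ : DirichletCharacter ℂ (2 ^ k), S ψ * ψ (u : ZMod (2 ^ k)) := by
    intro u
    rw [sum_units_progression_eq n k u hk, hfloorN, eq_inv_mul_iff_mul_eq₀ hφC, totient_mul_classSum_eq u (2 ^ (n + k))]
    exact Finset.sum_congr rfl fun ψ _ => mul_comm _ _
  -- the deviation is `φ⁻¹ Σ_ψ c(ψ) ψ(u)` with `c = S` off `χ₁` and `0` at `χ₁`
  set c : DirichletCharacter ℂ (2 ^ k) → ℂ := fun ψ => if ψ = χ₁ then 0 else S ψ with hc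
  have hdev : ∀ u : (ZMod (2 ^ k))ˣ,
      (∑ b : Fin (2 ^ n), ((liouville ((u : ZMod (2 ^ k)).val + 2 ^ k * (b : ℕ)) : ℤ) : ℂ))
        - χ₁ (u : ZMod (2 ^ k)) / ((Nat.totient (2 ^ k) : ℕ) : ℂ) *
          ∑ m : Fin (2 ^ (n + k)), ((liouville ((m : ℕ) + 1) : ℤ) : ℂ) * star (χ₁ (((m : ℕ) + 1 : ℕ) : ZMod (2 ^ k))) =
        ((Nat.totient (2 ^ k) : ℕ) : ℂ)⁻¹ * ∑ ψ : DirichletCharacter ℂ (2 ^ k), c ψ * ψ (u : ZMod (2 ^ k)) := by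
    intro u
    rw [hA u, hmain χ₁, ← Finset.add_sum_erase _ _ (Finset.mem_univ χ₁),
      ← Finset.add_sum_erase _ (fun ψ => c ψ * ψ (u : ZMod (2 ^ k))) (Finset.mem_univ χ₁)]
    have hc1 : c χ₁ = 0 := by
      show (if χ₁ = χ₁ then (0 : ℂ) else S χ₁) = 0
      rw [if_pos rfl]
    have hrest : ∑ ψ ∈ Finset.univ.erase χ₁, c ψ * ψ (u : ZMod (2 ^ k)) = ∑ ψ ∈ Finset.univ.erase χ₁, S ψ * ψ (u : ZMod (2 ^ k)) :=
      Finset.sum_congr rfl fun ψ hψ => by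
        show (if ψ = χ₁ then (0 : ℂ) else S ψ) * _ = _
        rw [if_neg (Finset.ne_of_mem_erase hψ)]
    rw [hc1, zero_mul, zero_add, hrest]
    field_simp
    ring
  -- Parseval
  have hnorm : ∀ u : (ZMod (2 ^ k))ˣ,
      ‖((Nat.totient (2 ^ k) : ℕ) : ℂ)⁻¹ * ∑ ψ : DirichletCharacter ℂ (2 ^ k), c ψ * ψ (u : ZMod (2 ^ k))‖ ^ 2 =
        ((Nat.totient (2 ^ k) : ℕ) : ℝ)⁻¹ ^ 2 * ‖∑ ψ : DirichletCharacter ℂ (2 ^ k), c ψ * ψ (u : ZMod (2 ^ k))‖ ^ 2 := by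
    intro u
    rw [norm_mul, norm_inv, Complex.norm_natCast, mul_pow]
  simp_rw [hdev, hnorm]
  rw [← Finset.mul_sum, parseval_units c]
  -- `Σ_ψ ‖c ψ‖² = Σ_{ψ ≠ χ₁} ‖S ψ‖²` and `‖S ψ‖ = ‖Σ λ ψ‖`
  have hcsum : ∑ ψ : DirichletCharacter ℂ (2 ^ k), ‖c ψ‖ ^ 2 = ∑ ψ ∈ Finset.univ.erase χ₁, ‖S ψ‖ ^ 2 := by
    rw [← Finset.add_sum_erase _ _ (Finset.mem_univ χ₁)]
    have hc1 : c χ₁ = 0 := by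
      show (if χ₁ = χ₁ then (0 : ℂ) else S χ₁) = 0
      rw [if_pos rfl]
    rw [hc1, norm_zero, zero_pow two_ne_zero, zero_add]
    exact Finset.sum_congr rfl fun ψ hψ => by
      show ‖(if ψ = χ₁ then (0 : ℂ) else S ψ)‖ ^ 2 = _
      rw [if_neg (Finset.ne_of_mem_erase hψ)]
  have hSnorm : ∀ ψ : DirichletCharacter ℂ (2 ^ k),
      ‖S ψ‖ = ‖∑ m : Fin (2 ^ (n + k)), ((liouville ((m : ℕ) + 1) : ℤ) : ℂ) * ψ (((m : ℕ) + 1 : ℕ) : ZMod (2 ^ k))‖ := by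
    intro ψ
    rw [← hmain ψ, ← norm_star, star_sum]
    congr 1
    refine Finset.sum_congr rfl fun m _ => ?_
    rw [star_mul', star_star, Complex.star_def, map_intCast]
  rw [hcsum]
  simp_rw [hSnorm]
  field_simp

/-! ## §4 The crux from a character mean-square statement -/

/-- **`AlignedTypeI` from a mean-square statement on Dirichlet characters to `2`-power moduli** (hypothesis spelled
out; it is the exact analytic residual of the leaf = the content of KMT 2023 Thm 1.3 for `λ`, `q = 2^k`): if for
every `ε > 0` there are `k₀, n₀` such that for all `n ≥ n₀`, `k₀ ≤ k ≤ n` some character `χ₁ (mod 2^k)` satisfies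
`Σ_{ψ ≠ χ₁} |Σ_{m ≤ 2^(n+k)} λ(m) ψ(m)|² ≤ ε 4^(n+k)`, then `AlignedTypeI`.  By `variance_eq_charMeanSquare` the
hypothesis gives `KMTVariance` (the variance is `φ⁻¹ · ε 4^(n+k) = 2 ε 2^k 4^n`), and `alignedTypeI_of_KMTVariance`
concludes. [folklore] -/
theorem alignedTypeI_of_charMeanSquare
    (h : ∀ ε : ℝ, 0 < ε → ∃ k₀ n₀ : ℕ, ∀ n ≥ n₀, ∀ k : ℕ, k₀ ≤ k → k ≤ n →
      ∃ χ₁ : DirichletCharacter ℂ (2 ^ k),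
        ∑ ψ ∈ (Finset.univ : Finset (DirichletCharacter ℂ (2 ^ k))).erase χ₁,
          ‖∑ m : Fin (2 ^ (n + k)), ((ArithmeticFunction.liouville ((m : ℕ) + 1) : ℤ) : ℂ) *
              ψ (((m : ℕ) + 1 : ℕ) : ZMod (2 ^ k))‖ ^ 2 ≤ ε * 4 ^ (n + k)) :
    Summit.ValiantsHypothesis.ValiantsHypothesis.Theses.LiouvilleSarnak.AlignedTypeI := by
  refine alignedTypeI_of_KMTVariance fun ε hε => ?_
  obtain ⟨k₀, n₀, hkn⟩ := h (ε / 2) (by positivity)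
  refine ⟨max k₀ 1, n₀, fun n hn k hk hkn' => ?_⟩
  have hk1 : 1 ≤ k := le_trans (le_max_right _ _) hk
  obtain ⟨χ₁, hχ₁⟩ := hkn n hn k (le_trans (le_max_left _ _) hk) hkn'
  refine ⟨χ₁, ?_⟩
  rw [variance_eq_charMeanSquare n k hk1 χ₁]
  have hφ : (Nat.totient (2 ^ k) : ℝ) = 2 ^ (k - 1) := by
    rw [Nat.totient_prime_pow Nat.prime_two hk1]
    push_cast
    ring
  have hφ0 : (0 : ℝ) < Nat.totient (2 ^ k) := by rw [hφ]; positivity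
  rw [inv_mul_le_iff₀ hφ0]
  refine hχ₁.trans (le_of_eq ?_)
  rw [hφ]
  have h2 : (2 : ℝ) ^ k = 2 * 2 ^ (k - 1) := by rw [← pow_succ', Nat.sub_add_cancel hk1]
  rw [pow_add, h2, show (4 : ℝ) ^ k = (2 ^ k) ^ 2 by rw [← pow_mul, mul_comm, pow_mul]; norm_num, h2]
  ring


/-- Conversely, `KMTVariance` gives the character mean-square statement (so the two are EQUIVALENT forms of the
leaf's residual): `Σ_{ψ ≠ χ₁} |Σ λψ|² = φ(2^k) · variance ≤ 2^(k-1) · ε 2^k 4^n = (ε/2) 4^(n+k)`. [folklore] -/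
theorem charMeanSquare_of_kmtVariance (h : KMTVariance) :
    ∀ ε : ℝ, 0 < ε → ∃ k₀ n₀ : ℕ, ∀ n ≥ n₀, ∀ k : ℕ, k₀ ≤ k → k ≤ n →
      ∃ χ₁ : DirichletCharacter ℂ (2 ^ k),
        ∑ ψ ∈ (Finset.univ : Finset (DirichletCharacter ℂ (2 ^ k))).erase χ₁,
          ‖∑ m : Fin (2 ^ (n + k)), ((ArithmeticFunction.liouville ((m : ℕ) + 1) : ℤ) : ℂ) *
              ψ (((m : ℕ) + 1 : ℕ) : ZMod (2 ^ k))‖ ^ 2 ≤ ε * 4 ^ (n + k) := by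
  intro ε hε
  obtain ⟨k₀, n₀, hkn⟩ := h ε hε
  refine ⟨max k₀ 1, n₀, fun n hn k hk hkn' => ?_⟩
  have hk1 : 1 ≤ k := le_trans (le_max_right _ _) hk
  obtain ⟨χ₁, hχ₁⟩ := hkn n hn k (le_trans (le_max_left _ _) hk) hkn'
  refine ⟨χ₁, ?_⟩
  rw [variance_eq_charMeanSquare n k hk1 χ₁] at hχ₁
  have hφ : (Nat.totient (2 ^ k) : ℝ) = 2 ^ (k - 1) := by
    rw [Nat.totient_prime_pow Nat.prime_two hk1]
    push_cast
    ring
  have hφ0 : (0 : ℝ) < Nat.totient (2 ^ k) := by rw [hφ]; positivity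
  rw [inv_mul_le_iff₀ hφ0] at hχ₁
  refine hχ₁.trans ?_
  rw [hφ]
  have h2 : (2 : ℝ) ^ k = 2 * 2 ^ (k - 1) := by rw [← pow_succ', Nat.sub_add_cancel hk1]
  rw [pow_add (4 : ℝ), show (4 : ℝ) ^ k = (2 ^ k) ^ 2 by rw [← pow_mul, mul_comm, pow_mul]; norm_num, h2]
  have h0 : (0 : ℝ) ≤ ε * (4 ^ n * (2 ^ (k - 1)) ^ 2) := by positivity
  calc (2 : ℝ) ^ (k - 1) * (ε * (2 * 2 ^ (k - 1)) * 4 ^ n) = ε * (4 ^ n * (2 ^ (k - 1)) ^ 2) * 2 := by ring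
    _ ≤ ε * (4 ^ n * (2 ^ (k - 1)) ^ 2) * 4 := by nlinarith
    _ = ε * (4 ^ n * (2 * 2 ^ (k - 1)) ^ 2) := by ring

end Summit.ValiantsHypothesis.ValiantsHypothesis.Theorems.LiouvilleSarnak.AlignedTypeI.CharactersModTwoN
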